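import Mathlib
import HarnessLib

/-!
# Venture HSemireg — a translation potential forces Euler characteristic zero

HONEST FRAMING. Lean leaf for the computation cell `pub-hsemireg` (theory seat th-3 gen 37; file of
record `run/shared/lean/pub/pub-hsemireg/theory/TH3-ESSENTIAL.md` §2, 2026-08-25). In the minimal
twisted-complex model of a «reduced-point complex» `F` on a smooth threefold germ (graded total space
`U = ⊕ₚ Mₚ`, parity operator `σ = (-1)^p`, three odd gluing operators `u₁ u₂ u₃`), the translation class
`τₖ` lies in the translation socle `W = {κ ∈ Ext¹(F,F) : κ·τⱼ = 0 ∀ j}` exactly when `τₖτⱼ = 0` for all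
`j`, i.e. when there is an odd potential `V` with `uₗ V + V uₗ = δₗₖ · 1` for all `l`. The observation
kernel-checked here: ONE such relation `u V + V u = c · 1` with `c ≠ 0` already forces the
super-dimension `str 1 = trace σ = χ(F) = Σₚ (-1)^p dim Mₚ` to vanish, because the supertrace of an
anticommutator of two odd operators is zero. This is the mechanism behind the exterior-algebra («CAR»)
beds of the cell, where `T ⊂ W`, `T(τ₁,τ₂,τ₃) = vol ⊗ 1` is a NON-ZERO operator and nevertheless
`str T = χ(Λ(k³)) = 0`: an object all of whose translation classes are translation-socle classes has
`χ = 0`, so the cubic form can never be detected on the translation classes themselves. Three finite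
identities in `Module.End F U` (any field, any module; `LinearMap.trace` is Mathlib's): the
anticommutator lemma, the vanishing of `trace σ`, and the resulting vanishing of `trace (σ P)` for every
`P` commuting with `u` (so every defect-free component of a class pairs to zero against such an object's
parity). The model, `Ext`, the classes and `χ` are NOT formalised; nothing here bears on (W³), HC, HC_CM
or HC_AV.
-/

namespace Summit.Ventures.HSemireg

variable {F : Type*} [Field F]
variable {U : Type*} [AddCommGroup U] [Module F U]

/-- **Supertrace of an odd anticommutator vanishes.** If `σ u = -(u σ)` (the operator `u` is odd for the
parity `σ`) then for every `V`: `trace (σ (u V + V u)) = 0`. Proof: `trace (σ u V) = -trace (u σ V)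
= -trace (σ V u)` by cyclicity. No hypothesis on `V` is needed. [folklore] -/
theorem supertrace_anticomm_eq_zero (σ u V : Module.End F U) (hσu : σ * u = -(u * σ)) :
    LinearMap.trace F U (σ * (u * V + V * u)) = 0 := by
  have h1 : σ * (u * V + V * u) = σ * u * V + σ * V * u := by noncomm_ring
  have h2 : σ * u * V = -(u * (σ * V)) := by
    calc σ * u * V = (σ * u) * V := by noncomm_ring
      _ = (-(u * σ)) * V := by rw [hσu]
      _ = -(u * (σ * V)) := by noncomm_ring
  have h3 : LinearMap.trace F U (σ * u * V) = -LinearMap.trace F U (σ * V * u) := by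
    rw [h2, map_neg, LinearMap.trace_mul_comm]
  rw [h1, map_add, h3]
  abel

/-- **A translation potential forces super-dimension zero.** If `σ u = -(u σ)` and some operator `V`
satisfies `u V + V u = c • 1` with `c ≠ 0` (a potential exhibiting the translation class in direction
`u` as a translation-socle class), then `trace σ = 0` — for the parity operator of a finite graded
space this is `Σₚ (-1)^p dim Mₚ = 0`. [folklore] -/
theorem trace_parity_eq_zero_of_anticomm_eq_smul_one (σ u V : Module.End F U) (c : F)
    (hσu : σ * u = -(u * σ)) (hc : c ≠ 0) (hV : u * V + V * u = c • (1 : Module.End F U)) :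
    LinearMap.trace F U σ = 0 := by
  have h := supertrace_anticomm_eq_zero σ u V hσu
  rw [hV, mul_smul_comm, mul_one, map_smul, smul_eq_mul] at h
  exact (mul_eq_zero.mp h).resolve_left hc

/-- **Defect-free components pair to zero against such a parity.** Under the same hypotheses, every
operator `P` commuting with `u` has `trace (σ P) = 0`: indeed `u (V P) + (V P) u = (u V + V u) P = c P`
when `P u = u P`, and the anticommutator lemma applies to `V P`. In the cell's language: on an object
with a translation potential in direction `u`, the supertrace of any `u`-commuting («defect-free»)
level-preserving operator vanishes. [folklore] -/
theorem supertrace_eq_zero_of_comm_of_anticomm_eq_smul_one (σ u V P : Module.End F U) (c : F)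
    (hσu : σ * u = -(u * σ)) (hc : c ≠ 0) (hV : u * V + V * u = c • (1 : Module.End F U))
    (hP : P * u = u * P) :
    LinearMap.trace F U (σ * P) = 0 := by
  have key : u * (V * P) + (V * P) * u = c • P := by
    have e1 : u * (V * P) + (V * P) * u = (u * V + V * u) * P := by
      calc u * (V * P) + (V * P) * u = u * V * P + V * (P * u) := by noncomm_ring
        _ = u * V * P + V * (u * P) := by rw [hP]
        _ = (u * V + V * u) * P := by noncomm_ring
    rw [e1, hV, smul_mul_assoc, one_mul]
  have h := supertrace_anticomm_eq_zero σ u (V * P) hσu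
  rw [key, mul_smul_comm, map_smul, smul_eq_mul] at h
  exact (mul_eq_zero.mp h).resolve_left hc

end Summit.Ventures.HSemireg
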